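import Summits.ABC.IUTFork.Joshi.TestThetaLociGenuineMover
import HarnessLib

/-!
# X-09 at GENUINE DATA, sequel (R-J census row Y-11) — at the print-normalised sharp setting of EVERY initial Θ-datum
# (`pilotDataOfK D L`) Dupuy–Hilado's (Ind2) moves the Θ-pilot region over the prime `2` at EVERY label, unconditionally:
# the ⊇-half of print's «are» FAILS for the Θ-reading of Joshi's locus, and rp-h3's `OrbitInside` FAILS

Proof-only sequel (0 definitions, 0 `Prop` facts, no `sorry`; abc-iut cell, block E / R-J census, rung LADDER-ABC:A2.E; seat
abc-iut-E-t22, gen 8) of `Joshi/TestThetaLociGenuine.lean` / `Joshi/TestThetaLociGenuineMover.lean` (this seat): there, ONE element of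
Dupuy–Hilado's (Ind2) `Real.ismDH` moving the unit ball at ONE finite place `v₀ | p` refutes the ⊇-half of [J-III] Thm-Def 9.8.1.1 (7)
«[the loci] are Mochizuki's multi-radial representations of Theta-values» (arXiv:2401.13508v4 p.116 l.43–50; K. Joshi, unrefereed) for
every Θ-INSIDE reading of Joshi's locus at abc-iut-c312-7's `settingPrVolSharp X …` — at the label `0` over `p` always, at every label
of `𝔽_l^⋇` over `p` when no bad place lies over `p` and the Θ-ideles are units off `S` — and puts the setting outside abc-iut-rp-h3's
class `OrbitInside`. HERE `X := pilotDataOfK D L`, the base-changed pilot data of an INITIAL Θ-DATUM `D` ([IUTchI] Def. 3.1) over any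
finite `L ⊇ F` (abc-iut-w5-d209 `Cor312ProvK`), where the mover hypothesis DISCHARGES at `p = 2`: `√−1 ∈ F ⊆ L` (Def. 3.1 (a),
abc-iut-w5-d039 `exists_sq_eq_neg_one_of_algebra`, `exists_mem_ismDH_image_closedBall_one_ne_of_exists_sq_eq_neg_one`), a place of
`L` over `2` exists (`placesOver_nonempty`), and no bad place lies over `2` (Def. 3.1 (b), `not_mem_pilotDataOfK_S_of_two_mem`):

* `exists_image_integers_ne_pilotDataOfK` — a dyadic place `w₀` of `L` and `ψ ∈ Real.ismDH (analyticLogv L) w₀` with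
  `ψ '' 𝒪_{w₀} ≠ 𝒪_{w₀}` (the mover, packaged once);
* `not_possibleImagesWithinLocus_settingPrVolSharp_pilotDataOfK` (label `0` over `2`; every reading whose shadow there lies inside
  the Θ-region; no hypothesis on the Θ-ideles) and `…_pilotDataOfK_labelSucc` (EVERY label of `𝔽_l^⋇` over `2`, Θ-ideles units
  off `S` — abc-iut-c312-7's `ht1`, satisfied by every family realising `P_Θ`): so the negative is NOT a label-`0` artefact of OUR
  signature (E-cx p431979) — print's `𝓘_Mochizuki = Π_p Π_{j=1}^{ℓ*} S_{j+1}𝓘_p` (Def. 9.4.6.7) has exactly the labels `j ≥ 1`;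
* **`not_orbitInside_settingPrVolSharp_pilotDataOfK`** — for EVERY initial Θ-datum the genuine sharp setting lies OUTSIDE rp-h3's
  barrier class `OrbitInside` (RP-H32 real cell: rp-h3 had the (Ind2) exit at a tame quadratically ramified `p₀ ≥ 5` off `S`
  (p446172 lineage) — here at the dyadic places every initial Θ-datum carries);
* `thetaReading_profile_settingPrVolSharp_pilotDataOfK` — THE Θ-reading (locus = the Θ-pilot's (Ind3)-region everywhere; E-t22's
  region signature p431723) EXISTS there with «⊆-rows TRUE, ⊇-half FALSE» — the genuine-data twin of abc-iut-E-t56's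
  `scal_theta_profile` (p434792) and the opposite of the isometric pinned model (p431723 `pinned_theta_split`, both halves TRUE).
**No side is taken** on [IUTchIII] Cor. 3.12 or on any author; typed ≠ proved; R13: «J-FALSE-AT-GENUINE» DATA for the test ledger,
located not adjudicated; HONEST SCOPE: OUR typed objects (c312-5's `logShellsDH`, DH's (Ind2) as ALL shell-preserving lattice
automorphisms, the SHARP (Ind3) reading); which (Ind2) print intends (isometries vs DH's lattice automorphisms) is E-LOCATION's attach
point A1, untouched here. [claim: Joshi2024ATS3, status: disputed] [claim: Mochizuki2012, status: disputed]
[cite: DupuyHilado2025, §3.9, §4.9] [cite: Mochizuki2012, IUTchI Def. 3.1 (a)(b) p. 61]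
-/
noncomputable section

open Set NumberField IsDedekindDomain

namespace Summit.ABC.IUTFork.Joshi

open Thm311 Thm311.Real Cor312 Cor312Vol Cor312Prov Literature.IUT.LogThetaLattice Literature.IUT.LogVolume
  Literature.IUT.HodgeTheaters
open Summit.ABC.IUTFork.Repair.CandDupuyHilado32 (OrbitInside)

section InitialK

variable {F K Fbar : Type} [Field F] [NumberField F] [Field K] [NumberField K] [Algebra F K] [Field Fbar]
  [Algebra F Fbar] [Algebra K Fbar] {E : WeierstrassCurve F} [E.IsElliptic] {l : ℕ} {Pb : BadPlacePredicates K}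
  (D : InitialThetaData F K Fbar E l Pb) (L : Type) [Field L] [NumberField L] [Algebra F L]
  {logv : PadicLogs L} (hlog : LogvAnalytic logv)
  (M : Type) [Field M] [NumberField M]
  (archPk : ∀ (j : (thetaIndex (pilotDataOfK D L)).Label) (vQ : (thetaIndex (pilotDataOfK D L)).VQ),
    Set ((logShellsDH (pilotDataOfK D L) logv).Packet j vQ))
  (archSub : ∀ (j : (thetaIndex (pilotDataOfK D L)).Label) (v : (thetaIndex (pilotDataOfK D L)).V),
    Set ((logShellsDH (pilotDataOfK D L) logv).Packet j ((thetaIndex (pilotDataOfK D L)).over v)))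
  (Ψ : ℤ → ∀ v : (thetaIndex (pilotDataOfK D L)).V, v ∈ (thetaIndex (pilotDataOfK D L)).Vbad →
    Set ((logShellsDH (pilotDataOfK D L) logv).StarPacket v))
  (act : ℤ → ∀ v : (thetaIndex (pilotDataOfK D L)).V, v ∈ (thetaIndex (pilotDataOfK D L)).Vbad →
    (logShellsDH (pilotDataOfK D L) logv).StarPacket v →
      Module.End ℚ ((logShellsDH (pilotDataOfK D L) logv).StarPacket v))
  (Mmod : ℤ → ∀ j : (thetaIndex (pilotDataOfK D L)).LabelStar,
    Set ((logShellsDH (pilotDataOfK D L) logv).GlobalPacket j.1))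
  (region : ℤ → ∀ j : (thetaIndex (pilotDataOfK D L)).LabelStar, FinDivisor M →
    ∀ vQ : (thetaIndex (pilotDataOfK D L)).VQ, Set ((logShellsDH (pilotDataOfK D L) logv).Packet j.1 vQ))
  (n : ℤ) {HT : Type} {LogLink : HT → HT → Type} {IsFull : ∀ {s t : HT}, LogLink s t → Prop}
  (lat : LGPGaussianLogThetaLattice LogLink IsFull)
  {Frd : Type} {IsoF : Frd → Frd → Type} {Ob : Frd → Type} {realify : Frd → Frd} {Strip : Type}
  {IsoS : Strip → Strip → Type}
  {Mv : ∀ v : (thetaIndex (pilotDataOfK D L)).V, v ∈ (thetaIndex (pilotDataOfK D L)).Vbad → Type}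
  [∀ v h, Monoid (Mv v h)]
  (sig : GlobalLGPFrobenioidSignature (thetaIndex (pilotDataOfK D L)).lstar (thetaIndex (pilotDataOfK D L)).V
    (· ∈ (thetaIndex (pilotDataOfK D L)).Vbad) Frd IsoF Ob realify Strip IsoS Mv)
  (split : SplittingMonoids Mv) {ObΔ : Type}
  {N : ∀ v : (thetaIndex (pilotDataOfK D L)).V, v ∈ (thetaIndex (pilotDataOfK D L)).Vbad → Type}
  [∀ v h, Monoid (N v h)] (qData : QPilotData ObΔ N)
  (t : ∀ (pp : Nat.Primes) (_ : Fin (pilotDataOfK D L).lstar) (x : (thetaIndex (pilotDataOfK D L)).Fibre (.inr pp)),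
    haveI : Fact (pp : ℕ).Prime := ⟨pp.2⟩; kOf (pilotDataOfK D L) pp.1 x)
  (tq : ∀ (pp : Nat.Primes) (x : (thetaIndex (pilotDataOfK D L)).Fibre (.inr pp)),
    haveI : Fact (pp : ℕ).Prime := ⟨pp.2⟩; kOf (pilotDataOfK D L) pp.1 x)
  (htq0 : ∀ pp x, tq pp x ≠ 0)
  (htq1 : ∀ (pp : Nat.Primes) (x : (thetaIndex (pilotDataOfK D L)).Fibre (.inr pp)),
    haveI : Fact (pp : ℕ).Prime := ⟨pp.2⟩; placeOf (pilotDataOfK D L) pp.1 x ∉ (pilotDataOfK D L).S → ‖tq pp x‖ = 1)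
  (col : ℤ → Column (logShellsDH (pilotDataOfK D L) logv))
  {W : Type} {V : W → Type} [∀ w, TopologicalSpace (V w)] {TJ TM : Type} [TopologicalSpace TJ] [TopologicalSpace TM]
  {C : ATS3.TensorPacketLociDatum W V TJ TM}

include D in
/-- **The dyadic mover every initial Θ-datum carries**: a place `w₀` of `L` over `2` and an element of Dupuy–Hilado's (Ind2)
`Real.ismDH (analyticLogv L) w₀` NOT mapping the unit ball `𝒪_{w₀}` onto itself (`√−1 ∈ F ⊆ L`, abc-iut-w5-d039; w5-d044's
dictionary `exists_ismDH_image_integers_ne_of_image_closedBall_ne`). [cite: Mochizuki2012, IUTchI Def. 3.1 (a) p. 61]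
[cite: DupuyHilado2025, §4.9] [cite: NeukirchANT1999, Ch. II (5.7), (7.13)] -/
theorem exists_image_integers_ne_pilotDataOfK :
    ∃ w₀ : HeightOneSpectrum (𝓞 L), residueChar L w₀ = 2 ∧
      ∃ ψ ∈ ismDH (analyticLogv L) (.inr w₀ : Thm311.Real.Place L),
        ⇑ψ '' (integers w₀ : Set (Thm311.Real.Carrier (.inr w₀ : Thm311.Real.Place L))) ≠ integers w₀ := by
  haveI : Fact (Nat.Prime 2) := ⟨Nat.prime_two⟩
  obtain ⟨w₀, hw₀⟩ := placesOver_nonempty L 2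
  have hres : residueChar L w₀ = 2 := (mem_placesOver_iff_residueChar w₀).mp hw₀
  set pp : Nat.Primes := ⟨2, Nat.prime_two⟩ with hpp
  haveI : Fact (pp : ℕ).Prime := ⟨pp.2⟩
  have hv₀ : (thetaIndex (pilotDataOfK D L)).over (.inr w₀) = .inr pp := by
    show Thm311.Real.Place.under (.inr w₀ : Thm311.Real.Place L) = .inr pp
    rw [Thm311.Real.Place.under_inr, Sum.inr.injEq]
    exact Subtype.ext hres
  have hv : ((pp : ℕ) : 𝓞 L) ∈ w₀.asIdeal := natCast_mem_placeOf (pilotDataOfK D L) pp ⟨.inr w₀, hv₀⟩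
  exact ⟨w₀, hres, exists_ismDH_image_integers_ne_of_image_closedBall_ne pp w₀ hv
    (exists_mem_ismDH_image_closedBall_one_ne_of_exists_sq_eq_neg_one (logvAnalyticAt_analyticLogv (F := L) (pp : ℕ)) w₀ hv rfl
      (exists_sq_eq_neg_one_of_algebra D L))⟩

/-- The place `w₀` of residue characteristic `2` lies in the fibre of `thetaIndex (pilotDataOfK D L)` over `2`. [folklore] -/
theorem over_inr_eq_two_pilotDataOfK (w₀ : HeightOneSpectrum (𝓞 L)) (hres : residueChar L w₀ = 2) :
    (thetaIndex (pilotDataOfK D L)).over (.inr w₀) = .inr ⟨2, Nat.prime_two⟩ := by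
  show Thm311.Real.Place.under (.inr w₀ : Thm311.Real.Place L) = .inr ⟨2, Nat.prime_two⟩
  rw [Thm311.Real.Place.under_inr, Sum.inr.injEq]
  exact Subtype.ext hres

/-- No bad place of `pilotDataOfK D L` lies over `2`, read on the fibre over `2` ([IUTchI] Def. 3.1 (b), abc-iut-w5-d039
`not_mem_pilotDataOfK_S_of_two_mem`). [cite: Mochizuki2012, IUTchI Def. 3.1 (b) p. 61] -/
theorem placeOf_two_not_mem_S_pilotDataOfK (x : (thetaIndex (pilotDataOfK D L)).Fibre (.inr ⟨2, Nat.prime_two⟩)) :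
    haveI : Fact (Nat.Prime 2) := ⟨Nat.prime_two⟩
    placeOf (pilotDataOfK D L) 2 x ∉ (pilotDataOfK D L).S :=
  haveI : Fact (Nat.Prime 2) := ⟨Nat.prime_two⟩
  not_mem_pilotDataOfK_S_of_two_mem D L (natCast_mem_placeOf (pilotDataOfK D L) 2 x)

/-- **FOR EVERY INITIAL Θ-DATUM, label `0`: the ⊇-half of print's «are» FAILS at the genuine sharp setting over `pilotDataOfK D L` for
every reading of every loci signature whose label-`0` shadow over the prime `2` lies inside the Θ-pilot's region** — unconditionally
(no hypothesis on the ideles). J-FALSE-AT-GENUINE data (R13). [cite: Mochizuki2012, IUTchI Def. 3.1 (a) p. 61] [cite: DupuyHilado2025, §4.9]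
[claim: Joshi2024ATS3, status: disputed] -/
theorem not_possibleImagesWithinLocus_settingPrVolSharp_pilotDataOfK
    {𝔇 : Dictionary ({ toSituation := situationPrVol (pilotDataOfK D L) hlog M archPk archSub Ψ act Mmod region, col := col } :
      LatticeSituation (thetaIndex (pilotDataOfK D L)))}
    (R : LociReading (settingPrVolSharp (pilotDataOfK D L) hlog M archPk archSub Ψ act Mmod region n lat sig split qData tq t
      htq0 htq1) C 𝔇)
    (hin : R.locusRegion 0 (.inr ⟨2, Nat.prime_two⟩) ⊆
      (settingPrVolSharp (pilotDataOfK D L) hlog M archPk archSub Ψ act Mmod region n lat sig split qData tq t htq0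
        htq1).thetaRegion3 0 (.inr ⟨2, Nat.prime_two⟩)) :
    ¬ R.PossibleImagesWithinLocus := by
  obtain ⟨w₀, hres, hmov⟩ := exists_image_integers_ne_pilotDataOfK D L
  obtain rfl : logv = analyticLogv L := GenuinePinsEmpty.eq_analyticLogv_of_logvAnalytic hlog
  obtain ⟨g₀, hg₀, x₀, hx₀, hgx₀⟩ := exists_mover_of_image_integers_ne (pilotDataOfK D L) hlog ⟨2, Nat.prime_two⟩ w₀
    (over_inr_eq_two_pilotDataOfK D L w₀ hres) hmov
  exact not_possibleImagesWithinLocus_settingPrVolSharp_of_mover_zero (pilotDataOfK D L) hlog M archPk archSub Ψ act Mmod region n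
    lat sig split qData t tq htq0 htq1 col ⟨2, Nat.prime_two⟩ ⟨.inr w₀, over_inr_eq_two_pilotDataOfK D L w₀ hres⟩ hg₀ hx₀ hgx₀ R hin

/-- **FOR EVERY INITIAL Θ-DATUM, EVERY LABEL OF `𝔽_l^⋇`: the ⊇-half of print's «are» FAILS at the genuine sharp setting over
`pilotDataOfK D L` for every reading whose shadow at `(i+1, 2)` lies inside the Θ-pilot's region**, for Θ-ideles that are units off
`S` (abc-iut-c312-7's `ht1`, every family realising `P_Θ`) — NOT a label-`0` artefact: print's `𝓘_Mochizuki` has exactly the labels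
`j = 1, …, ℓ*` ([J-III] Def. 9.4.6.7). J-FALSE-AT-GENUINE data (R13). [cite: Mochizuki2012, IUTchI Def. 3.1 (a)(b) p. 61]
[cite: DupuyHilado2025, §3.9, §4.9] [claim: Joshi2024ATS3, status: disputed] -/
theorem not_possibleImagesWithinLocus_settingPrVolSharp_pilotDataOfK_labelSucc
    (ht1 : ∀ (pp : Nat.Primes) (i : Fin (pilotDataOfK D L).lstar) (x : (thetaIndex (pilotDataOfK D L)).Fibre (.inr pp)),
      haveI : Fact (pp : ℕ).Prime := ⟨pp.2⟩; placeOf (pilotDataOfK D L) pp.1 x ∉ (pilotDataOfK D L).S → ‖t pp i x‖ = 1)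
    (i : Fin (thetaIndex (pilotDataOfK D L)).lstar)
    {𝔇 : Dictionary ({ toSituation := situationPrVol (pilotDataOfK D L) hlog M archPk archSub Ψ act Mmod region, col := col } :
      LatticeSituation (thetaIndex (pilotDataOfK D L)))}
    (R : LociReading (settingPrVolSharp (pilotDataOfK D L) hlog M archPk archSub Ψ act Mmod region n lat sig split qData tq t
      htq0 htq1) C 𝔇)
    (hin : R.locusRegion (Setting.labelSucc i) (.inr ⟨2, Nat.prime_two⟩) ⊆
      (settingPrVolSharp (pilotDataOfK D L) hlog M archPk archSub Ψ act Mmod region n lat sig split qData tq t htq0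
        htq1).thetaRegion3 (Setting.labelSucc i) (.inr ⟨2, Nat.prime_two⟩)) :
    ¬ R.PossibleImagesWithinLocus := by
  obtain ⟨w₀, hres, hmov⟩ := exists_image_integers_ne_pilotDataOfK D L
  obtain rfl : logv = analyticLogv L := GenuinePinsEmpty.eq_analyticLogv_of_logvAnalytic hlog
  exact not_possibleImagesWithinLocus_settingPrVolSharp_of_image_integers_ne_labelSucc (pilotDataOfK D L) hlog M archPk archSub Ψ
    act Mmod region n lat sig split qData t tq htq0 htq1 col ht1 ⟨2, Nat.prime_two⟩ w₀ (over_inr_eq_two_pilotDataOfK D L w₀ hres)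
    hmov (placeOf_two_not_mem_S_pilotDataOfK D L) i R hin

/-- **FOR EVERY INITIAL Θ-DATUM the genuine sharp setting over `pilotDataOfK D L` lies OUTSIDE rp-h3's barrier class `OrbitInside`**
(Θ-ideles units off `S`; every `L`, every analytic `logv`, all binders): the dyadic (Ind2) mover carries a point of the Θ-region at
`(1, 2)` out of it. RP-H32 real cell, unconditional form. [cite: Mochizuki2012, IUTchI Def. 3.1 (a)(b) p. 61]
[cite: DupuyHilado2025, §3.9, §4.9] [cite: DupuyHilado2020, §6.2 pp. 19–20] -/
theorem not_orbitInside_settingPrVolSharp_pilotDataOfK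
    (ht1 : ∀ (pp : Nat.Primes) (i : Fin (pilotDataOfK D L).lstar) (x : (thetaIndex (pilotDataOfK D L)).Fibre (.inr pp)),
      haveI : Fact (pp : ℕ).Prime := ⟨pp.2⟩; placeOf (pilotDataOfK D L) pp.1 x ∉ (pilotDataOfK D L).S → ‖t pp i x‖ = 1) :
    ¬ OrbitInside
        ({ toSituation := situationPrVol (pilotDataOfK D L) hlog M archPk archSub Ψ act Mmod region, col := col } :
          LatticeSituation (thetaIndex (pilotDataOfK D L)))
        (settingPrVolSharp (pilotDataOfK D L) hlog M archPk archSub Ψ act Mmod region n lat sig split qData tq t htq0 htq1) := by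
  obtain ⟨w₀, hres, hmov⟩ := exists_image_integers_ne_pilotDataOfK D L
  obtain rfl : logv = analyticLogv L := GenuinePinsEmpty.eq_analyticLogv_of_logvAnalytic hlog
  exact not_orbitInside_settingPrVolSharp_of_image_integers_ne (pilotDataOfK D L) hlog M archPk archSub Ψ act Mmod region n lat sig
    split qData t tq htq0 htq1 col ht1 ⟨2, Nat.prime_two⟩ w₀ (over_inr_eq_two_pilotDataOfK D L w₀ hres) hmov
    (placeOf_two_not_mem_S_pilotDataOfK D L)

/-- **THE Θ-READING AT EVERY INITIAL Θ-DATUM: ⊆-rows TRUE, «are» (⊇-half) FALSE.** At the genuine sharp setting over `pilotDataOfK D L`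
(every `L`, every analytic `logv`, all binders, any ideles) and for every seed dictionary there is a reading of a loci signature — E-t22's
region signature on the Θ-regions, locus = the Θ-pilot's (Ind3)-region in every packet — with `LocusWithinPossibleImages ∧
LocusWithinHull ∧ ¬ PossibleImagesWithinLocus`: Joshi's locus read AS Mochizuki's Θ-values locus is not the multiradial representation
under Dupuy–Hilado's (Ind2). Genuine twin of `scal_theta_profile` (p434792); contrast `pinned_theta_split` (p431723, isometric (Ind2):
both halves). Located, no verdict. [claim: Joshi2024ATS3, status: disputed] [claim: Mochizuki2012, status: disputed] -/
theorem thetaReading_profile_settingPrVolSharp_pilotDataOfK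
    (𝔇 : Dictionary ({ toSituation := situationPrVol (pilotDataOfK D L) hlog M archPk archSub Ψ act Mmod region, col := col } :
      LatticeSituation (thetaIndex (pilotDataOfK D L)))) :
    ∃ R : LociReading (settingPrVolSharp (pilotDataOfK D L) hlog M archPk archSub Ψ act Mmod region n lat sig split qData tq t
        htq0 htq1)
        (regionLoci ({ toSituation := situationPrVol (pilotDataOfK D L) hlog M archPk archSub Ψ act Mmod region, col := col } :
          LatticeSituation (thetaIndex (pilotDataOfK D L))) _
          (thetaRegion3_settingPrVolSharp_nonempty (pilotDataOfK D L) hlog M archPk archSub Ψ act Mmod region n lat sig split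
            qData t tq htq0 htq1)) 𝔇,
      R.LocusWithinPossibleImages ∧ R.LocusWithinHull ∧ ¬ R.PossibleImagesWithinLocus := by
  obtain ⟨R, hR⟩ := exists_thetaReading_settingPrVolSharp (pilotDataOfK D L) hlog M archPk archSub Ψ act Mmod region n lat sig
    split qData t tq htq0 htq1 col 𝔇
  exact ⟨R, locusWithinPossibleImages_of_subset_thetaRegion3 R fun j vQ => (hR j vQ).le,
    locusWithinHull_of_subset_thetaRegion3 R fun j vQ => (hR j vQ).le,
    not_possibleImagesWithinLocus_settingPrVolSharp_pilotDataOfK D L hlog M archPk archSub Ψ act Mmod region n lat sig split qData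
      t tq htq0 htq1 col R (hR 0 _).le⟩

end InitialK

end Summit.ABC.IUTFork.Joshi

end
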